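import Literature.Analysis.FluidPDE.VectorCalculus

/-!
# Crux `SelfMixingDichotomy.CoherentScaleExclusion` (stmt-NavierStokesRegularity-1423), line
  `registered`: the kinematic swirl witness is divergence free

Helper file (theorems only; lands `--supports stmt-NavierStokesRegularity-1423`) for the
registered stub `kinWitness_isDivFree_swirlField` of the lead's skeleton
(`Summit.NavierStokesRegularity.NavierStokesRegularity.Theses.SelfMixingDichotomy.CoherentScaleExclusion`).
The time slices of the kinematic witness are the swirl fields
`x ↦ (a · φ(‖x‖²)) • J x` on `ℝ³ = EuclideanSpace ℝ (Fin 3)`, where `J x = (−x₁, x₀, 0)` is the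
generator of rotations about the `x₂`-axis. Such a field is divergence free:
`D(g • J)(x) h = g(x) • J h + (Dg(x) h) • J x` with `g = a · φ(‖·‖²)`,
`Dg(x) h = a φ'(‖x‖²) · 2⟪x, h⟫`, so that
`div = g(x) · tr J + Dg(x)(J x) = 0 + 2 a φ'(‖x‖²) ⟪x, J x⟫ = 0`,
because `J` has zero diagonal and `⟪x, J x⟫ = −x₀ x₁ + x₁ x₀ = 0`.
-/

set_option linter.dupNamespace false

namespace Summit.NavierStokesRegularity.NavierStokesRegularity.Theorems

open Literature.Analysis.FluidPDE
open scoped RealInnerProductSpace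

/-- **The swirl field `x ↦ (a · φ(‖x‖²)) • (−x₁, x₀, 0)` is divergence free** for every `C¹`
profile `φ : ℝ → ℝ` and amplitude `a : ℝ`: its derivative at `x` is
`g(x) • J + (Dg(x) ·) • J x` (`g = a · φ(‖·‖²)`, `J` the rotation generator about the `x₂`-axis),
whose trace is `g(x) · tr J + Dg(x)(J x) = 0` since `tr J = 0` and `⟪x, J x⟫ = 0` (stub
`kinWitness_isDivFree_swirlField` of crux stmt-NavierStokesRegularity-1423, line `registered`;
product rule `HasFDerivAt.smul`, `hasStrictFDerivAt_norm_sq`, and the tree's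
`divergence_eq_sum_inner_fderiv` in the standard basis). [folklore] -/
theorem kinWitness_isDivFree_swirlField : ∀ (φ : ℝ → ℝ), ContDiff ℝ 1 φ → ∀ a : ℝ, Literature.Analysis.FluidPDE.VectorCalculus.IsDivFree (fun x : EuclideanSpace ℝ (Fin 3) => (a * φ (‖x‖ ^ 2)) • (WithLp.toLp 2 ![-(x 1), x 0, 0] : EuclideanSpace ℝ (Fin 3))) := by
  intro φ hφ a x
  -- the rotation generator `J y = (-y₁, y₀, 0)` as a continuous linear map
  obtain ⟨J, hJ⟩ : ∃ J : EuclideanSpace ℝ (Fin 3) →L[ℝ] EuclideanSpace ℝ (Fin 3),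
      ∀ y, J y = (WithLp.toLp 2 ![-(y 1), y 0, 0] : EuclideanSpace ℝ (Fin 3)) :=
    ⟨LinearMap.toContinuousLinearMap
      { toFun := fun y => (WithLp.toLp 2 ![-(y 1), y 0, 0] : EuclideanSpace ℝ (Fin 3))
        map_add' := fun y z => by
          ext i
          fin_cases i <;> simp [add_comm]
        map_smul' := fun c y => by
          ext i
          fin_cases i <;> simp },
      fun y => rfl⟩
  -- the scalar amplitude `g y = a * φ (‖y‖ ^ 2)` and its derivative at `x`
  have hφ' : HasDerivAt φ (deriv φ (‖x‖ ^ 2)) (‖x‖ ^ 2) :=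
    ((hφ.differentiable one_ne_zero) _).hasDerivAt
  have hg := (hφ'.comp_hasFDerivAt x (hasStrictFDerivAt_norm_sq x).hasFDerivAt).const_mul a
  -- the product rule for `g • J`
  have hv := hg.fun_smul J.hasFDerivAt
  have hfun : (fun y : EuclideanSpace ℝ (Fin 3) =>
      (a * φ (‖y‖ ^ 2)) • (WithLp.toLp 2 ![-(y 1), y 0, 0] : EuclideanSpace ℝ (Fin 3))) =
      fun y => (a * (φ ∘ fun y : EuclideanSpace ℝ (Fin 3) => ‖y‖ ^ 2) y) • J y := by
    funext y
    rw [hJ]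
    rfl
  rw [hfun, divergence_eq_sum_inner_fderiv (EuclideanSpace.basisFun (Fin 3) ℝ), hv.fderiv]
  simp [Fin.sum_univ_three, hJ, EuclideanSpace.inner_single_left, EuclideanSpace.inner_single_right]
  ring
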